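import Summits.KontsevichZagierPeriods.KontsevichZagierPeriods.Theorems.LinRedNormalFormArrangementNormalFormStubRebaseSimplePosOneFibreSwapForms

/-!
# Stub `stub_rebaseSimplePosOne` (crux `ArrangementNormalForm`, line `janus-bands`, v6.2) —
part `Swap`: the coordinate swap `y ↔ t` of a one-fibre band

The coordinate swap `w ↦ w ∘ (y t)` (rule 2, a permutation of coordinates, Jacobian `±1`:
`RebasePos.abs_det_swapLin`) maps a band `{rows(x', y) > 0, u(x', y) < t < v(x', y)}` with
transverse bounds of the same sign in `y`, letter `0` and exponents `n₁ = 0`, `n₂ = 1` to a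
bounded representation with
* the literal integrand `g(x') · 1/(Y − 0) · 1/(T − ℓ₂(x'))` (`n₂ = 1`, base letter `0`, fibre
  letter `(snoc ℓ₂ 0, ℓ₂₀)`, free of `Y`), and
* an ORDER-CONSTRAINED domain (the constraint set `swC M u v` of part `SwapForms`: every
  fibre compared from both sides, affine players `Y`-free or the transverse forms
  `invF u`, `invF v`),
ready for the total-order refinement `RebasePos.orderCells_good` (`RebasePos.swapBandYT`, registered as
`rebaseSimplePos_swapYT`; the constraint set is exported through its three properties only). In
the cells the fibre `T` has the `Y`-free letter `ℓ₂`: a `Y`-free bound gives the product case,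
and two transverse bounds give a band whose apex level is `y* − ℓ₂` (the ORIGINAL `y`-distance
from the apex to the pole) in place of `κ`: the swap exchanges the two degenerations of the
corner (part `SwapBand`).

References: M. Kontsevich, D. Zagier, *Periods* (2001), §1.2, rule (2).
-/

noncomputable section

open Set MeasureTheory MvPolynomial
open Literature.NumberTheory.Transcendental Literature.ModelTheory.ExponentialFields

namespace Summit.KontsevichZagierPeriods.ArrangementNormalForm.JanusBands

namespace RebasePos

open SeparatePos

section SwapMove

variable {B m m' : ℕ}

/-- The order-constrained set of a finite family of comparisons is semialgebraic. -/
theorem isSemialgebraic_orderSet {K : ℕ}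
    (C : Finset ((Fin K ⊕ ((Fin (B + 1) → ℚ) × ℚ)) × (Fin K ⊕ ((Fin (B + 1) → ℚ) × ℚ)))) :
    IsSemialgebraic ℚ {w : Fin (B + 1 + K) → ℝ | ∀ q ∈ C, pv q.1 w < pv q.2 w} := by
  have h : {w : Fin (B + 1 + K) → ℝ | ∀ q ∈ C, pv q.1 w < pv q.2 w} =
      ⋂ q ∈ C, {w | 0 < aeval w (playerPoly q.2 - playerPoly q.1)} := by
    ext w
    simp only [mem_setOf_eq, mem_iInter, map_sub, aeval_playerPoly, sub_pos, pv]
  rw [h]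
  exact IsSemialgebraic.biInter _ _ fun q _ => isSemialgebraic_setOf_eval_pos _

/-- The swap as a continuous linear map is `w ↦ w ∘ (y t)`. -/
theorem swapLin_apply (w : Fin (B + 1 + 1) → ℝ) : (LinearMap.toContinuousLinearMap (LinearMap.funLeft ℝ ℝ (Equiv.swap (Fin.castAdd 1 (Fin.last B)) (RebasePos.tI B))) : (Fin (B + 1 + 1) → ℝ) →L[ℝ] (Fin (B + 1 + 1) → ℝ)) w = (fun l : Fin (B + 1 + 1) => w ((Equiv.swap (Fin.castAdd 1 (Fin.last B)) (RebasePos.tI B)) l)) := rfl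

/-- The Jacobian of the swap has absolute value `1` (the swap is an involution). -/
theorem abs_det_swapLin : |((LinearMap.toContinuousLinearMap (LinearMap.funLeft ℝ ℝ (Equiv.swap (Fin.castAdd 1 (Fin.last B)) (RebasePos.tI B))) : (Fin (B + 1 + 1) → ℝ) →L[ℝ] (Fin (B + 1 + 1) → ℝ))).det| = 1 := by
  have hcomp : ((LinearMap.toContinuousLinearMap (LinearMap.funLeft ℝ ℝ (Equiv.swap (Fin.castAdd 1 (Fin.last B)) (RebasePos.tI B))) : (Fin (B + 1 + 1) → ℝ) →L[ℝ] (Fin (B + 1 + 1) → ℝ)) : (Fin (B + 1 + 1) → ℝ) →ₗ[ℝ] (Fin (B + 1 + 1) → ℝ)).comp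
      ((LinearMap.toContinuousLinearMap (LinearMap.funLeft ℝ ℝ (Equiv.swap (Fin.castAdd 1 (Fin.last B)) (RebasePos.tI B))) : (Fin (B + 1 + 1) → ℝ) →L[ℝ] (Fin (B + 1 + 1) → ℝ)) : (Fin (B + 1 + 1) → ℝ) →ₗ[ℝ] (Fin (B + 1 + 1) → ℝ)) = LinearMap.id := by
    refine LinearMap.ext fun w => ?_
    show (fun l : Fin (B + 1 + 1) => ((fun l : Fin (B + 1 + 1) => w ((Equiv.swap (Fin.castAdd 1 (Fin.last B)) (RebasePos.tI B)) l))) ((Equiv.swap (Fin.castAdd 1 (Fin.last B)) (RebasePos.tI B)) l)) = w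
    exact swapYT_swapYT w
  have h := congrArg LinearMap.det hcomp
  rw [LinearMap.det_comp, LinearMap.det_id] at h
  have h2 : |((LinearMap.toContinuousLinearMap (LinearMap.funLeft ℝ ℝ (Equiv.swap (Fin.castAdd 1 (Fin.last B)) (RebasePos.tI B))) : (Fin (B + 1 + 1) → ℝ) →L[ℝ] (Fin (B + 1 + 1) → ℝ))).det| * |((LinearMap.toContinuousLinearMap (LinearMap.funLeft ℝ ℝ (Equiv.swap (Fin.castAdd 1 (Fin.last B)) (RebasePos.tI B))) : (Fin (B + 1 + 1) → ℝ) →L[ℝ] (Fin (B + 1 + 1) → ℝ))).det| = 1 := by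
    rw [← abs_mul, ContinuousLinearMap.det, h, abs_one]
  rcases mul_self_eq_one_iff.mp h2 with h3 | h3
  · exact h3
  · linarith [abs_nonneg (((LinearMap.toContinuousLinearMap (LinearMap.funLeft ℝ ℝ (Equiv.swap (Fin.castAdd 1 (Fin.last B)) (RebasePos.tI B))) : (Fin (B + 1 + 1) → ℝ) →L[ℝ] (Fin (B + 1 + 1) → ℝ))).det)]

variable (L : Fin m → (Fin B → ℚ) × ℚ) (e : Fin m → ℕ) (ℓ₁ ℓ₂ : (Fin B → ℚ) × ℚ)

/-- **The coordinate swap `y ↔ t` of a one-fibre band** (rule 2). A band `{rows, u < t < v}`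
with transverse bounds of the same sign in `y`, letter `0` and exponents `n₁ = 0`, `n₂ = 1` is
congruent modulo `KZ.relations` to a bounded representation with an order-constrained domain
(constraint set `C`: every fibre compared from both sides; affine players `Y`-free or
`invF u`, `invF v`), which is the preimage of the band under the swap, and with the literal
integrand with base letter `0` and fibre letter `ℓ₂` lifted (free of `Y`). -/
theorem swapBandYT (s : KZ.IntegralRep (B + 1 + 1)) (M : Fin m' → (Fin (B + 1) → ℚ) × ℚ)
    (p : MvPolynomial (Fin B) ℚ) (u v : (Fin (B + 1) → ℚ) × ℚ) (hbd : Bornology.IsBounded s.domain)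
    (hdom : s.domain = gDom B 1 m' M (fun _ => Sum.inr u) (fun _ => Sum.inr v))
    (hint : EqOn s.integrand (glit B 1 p L e ℓ₁ ℓ₂ 0 1 (fun _ => some 0)) s.domain)
    (hu : u.1 (Fin.last B) ≠ 0) (hv : v.1 (Fin.last B) ≠ 0)
    (hsame : 0 < u.1 (Fin.last B) ↔ 0 < v.1 (Fin.last B)) :
    ∃ (C : Finset ((Fin 1 ⊕ ((Fin (B + 1) → ℚ) × ℚ)) × (Fin 1 ⊕ ((Fin (B + 1) → ℚ) × ℚ))))
      (s' : KZ.IntegralRep (B + 1 + 1)),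
      (∀ i, (∃ q ∈ C, q.2 = Sum.inl i) ∧ (∃ q ∈ C, q.1 = Sum.inl i)) ∧
      (∀ q ∈ C, ∀ d, (q.1 = Sum.inr d ∨ q.2 = Sum.inr d) →
        d.1 (Fin.last B) = 0 ∨ d = (((Fin.snoc (fun i : Fin B => -u.1 (Fin.castSucc i) / u.1 (Fin.last B)) (1 / u.1 (Fin.last B)) : Fin (B + 1) → ℚ), -u.2 / u.1 (Fin.last B)) : (Fin (B + 1) → ℚ) × ℚ) ∨ d = (((Fin.snoc (fun i : Fin B => -v.1 (Fin.castSucc i) / v.1 (Fin.last B)) (1 / v.1 (Fin.last B)) : Fin (B + 1) → ℚ), -v.2 / v.1 (Fin.last B)) : (Fin (B + 1) → ℚ) × ℚ)) ∧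
      s'.domain = {w | ∀ q ∈ C, pv q.1 w < pv q.2 w} ∧
      (∀ w, w ∈ s'.domain ↔ (fun l : Fin (B + 1 + 1) => w ((Equiv.swap (Fin.castAdd 1 (Fin.last B)) (RebasePos.tI B)) l)) ∈ s.domain) ∧ Bornology.IsBounded s'.domain ∧
      EqOn s'.integrand (glit B 1 p L e ℓ₁ 0 0 1 (fun _ => some (((Fin.snoc (ℓ₂).1 0 : Fin (B + 1) → ℚ), (ℓ₂).2) : (Fin (B + 1) → ℚ) × ℚ))) s'.domain ∧
      KZ.of s - KZ.of s' ∈ KZ.relations := by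
  set D' : Set (Fin (B + 1 + 1) → ℝ) := {w | ∀ q ∈ ((Finset.univ.image fun j => (if (M j).1 (Fin.last B) = 0 then ((Sum.inr 0, Sum.inr (M j)) : ((Fin 1 ⊕ ((Fin (B + 1) → ℚ) × ℚ)) × (Fin 1 ⊕ ((Fin (B + 1) → ℚ) × ℚ)))) else if 0 < (M j).1 (Fin.last B) then (Sum.inr (((Fin.snoc (fun i : Fin B => -(M j).1 (Fin.castSucc i) / (M j).1 (Fin.last B)) 0 : Fin (B + 1) → ℚ), -(M j).2 / (M j).1 (Fin.last B)) : (Fin (B + 1) → ℚ) × ℚ), Sum.inl 0) else (Sum.inl 0, Sum.inr (((Fin.snoc (fun i : Fin B => -(M j).1 (Fin.castSucc i) / (M j).1 (Fin.last B)) 0 : Fin (B + 1) → ℚ), -(M j).2 / (M j).1 (Fin.last B)) : (Fin (B + 1) → ℚ) × ℚ)))) ∪ (({(if 0 < u.1 (Fin.last B) then ((Sum.inl 0, Sum.inr (((Fin.snoc (fun i : Fin B => -u.1 (Fin.castSucc i) / u.1 (Fin.last B)) (1 / u.1 (Fin.last B)) : Fin (B + 1) → ℚ), -u.2 / u.1 (Fin.last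 B)) : (Fin (B + 1) → ℚ) × ℚ)) : ((Fin 1 ⊕ ((Fin (B + 1) → ℚ) × ℚ)) × (Fin 1 ⊕ ((Fin (B + 1) → ℚ) × ℚ)))) else (Sum.inr (((Fin.snoc (fun i : Fin B => -u.1 (Fin.castSucc i) / u.1 (Fin.last B)) (1 / u.1 (Fin.last B)) : Fin (B + 1) → ℚ), -u.2 / u.1 (Fin.last B)) : (Fin (B + 1) → ℚ) × ℚ), Sum.inl 0)), (if 0 < v.1 (Fin.last B) then ((Sum.inr (((Fin.snoc (fun i : Fin B => -v.1 (Fin.castSucc i) / v.1 (Fin.last B)) (1 / v.1 (Fin.last B)) : Fin (B + 1) → ℚ), -v.2 / v.1 (Fin.last B)) : (Fin (B + 1) → ℚ) × ℚ), Sum.inl 0) : ((Fin 1 ⊕ ((Fin (B + 1) → ℚ) × ℚ)) × (Fin 1 ⊕ ((Fin (B + 1) → ℚ) × ℚ)))) else (Sum.inl 0, Sum.inr (((Fin.snoc (fun i : Fin B => -v.1 (Fin.castSucc i) / v.1 (Fin.last B)) (1 / v.1 (Fin.last B)) : Fin (B + 1) → ℚ), -v.2 / v.1 (Fin.last B)) :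 (Fin (B + 1) → ℚ) × ℚ)))}) : Finset ((Fin 1 ⊕ ((Fin (B + 1) → ℚ) × ℚ)) × (Fin 1 ⊕ ((Fin (B + 1) → ℚ) × ℚ))))), pv q.1 w < pv q.2 w} with hD'
  set f' := glit B 1 p L e ℓ₁ 0 0 1 (fun _ => some (((Fin.snoc (ℓ₂).1 0 : Fin (B + 1) → ℚ), (ℓ₂).2) : (Fin (B + 1) → ℚ) × ℚ)) with hf'
  have hΨdom : ∀ w, w ∈ D' ↔ (fun l : Fin (B + 1 + 1) => w ((Equiv.swap (Fin.castAdd 1 (Fin.last B)) (RebasePos.tI B)) l)) ∈ s.domain := fun w => by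
    rw [hdom]
    exact swC_iff M u v hu hv w
  -- the new integrand is the old one after the swap (Jacobian `±1`)
  have hff' : ∀ w ∈ D', f' w = s.integrand (fun l : Fin (B + 1 + 1) => w ((Equiv.swap (Fin.castAdd 1 (Fin.last B)) (RebasePos.tI B)) l)) := fun w hw => by
    rw [hint ((hΨdom w).1 hw), hf', glit_one, glit_one]
    simp only [swapEquiv_x, affB_swapYT, pow_zero, pow_one, affF_zero'', sub_zero, affB_zeroYT,
      affF_liftB, swapEquiv_y]
    rw [show w ((Equiv.swap (Fin.castAdd 1 (Fin.last B)) (tI B)) (Fin.natAdd (B + 1) 0)) =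
      w (Fin.castAdd 1 (Fin.last B)) by rw [swapEquiv_t]]
    ring
  -- semialgebraicity and calculus
  have hD'sa : IsSemialgebraic ℚ D' := isSemialgebraic_orderSet _
  have hf'sa : IsSemialgebraicFunOn ℚ D' f' := isSemialgebraicFunOn_glit hD'sa _ L e ℓ₁ _ _ _ _
  have hΨsa : IsSemialgebraicMapOn ℚ D' (fun w : Fin (B + 1 + 1) → ℝ => (fun l : Fin (B + 1 + 1) => w ((Equiv.swap (Fin.castAdd 1 (Fin.last B)) (RebasePos.tI B)) l))) :=
    (isSemialgebraicMapOn_aeval hD'sa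
      (fun l => X ((Equiv.swap (Fin.castAdd 1 (Fin.last B)) (tI B)) l))).congr
      fun w _ => by funext l; simp
  have hderiv : ∀ w ∈ D', HasFDerivWithinAt (fun w : Fin (B + 1 + 1) → ℝ => (fun l : Fin (B + 1 + 1) => w ((Equiv.swap (Fin.castAdd 1 (Fin.last B)) (RebasePos.tI B)) l))) (LinearMap.toContinuousLinearMap (LinearMap.funLeft ℝ ℝ (Equiv.swap (Fin.castAdd 1 (Fin.last B)) (RebasePos.tI B))) : (Fin (B + 1 + 1) → ℝ) →L[ℝ] (Fin (B + 1 + 1) → ℝ)) D' w :=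
    fun w _ => ((LinearMap.toContinuousLinearMap (LinearMap.funLeft ℝ ℝ (Equiv.swap (Fin.castAdd 1 (Fin.last B)) (RebasePos.tI B))) : (Fin (B + 1 + 1) → ℝ) →L[ℝ] (Fin (B + 1 + 1) → ℝ))).hasFDerivAt.hasFDerivWithinAt
  have hinj : InjOn (fun w : Fin (B + 1 + 1) → ℝ => (fun l : Fin (B + 1 + 1) => w ((Equiv.swap (Fin.castAdd 1 (Fin.last B)) (RebasePos.tI B)) l))) D' := fun w _ w' _ h => by
    have h' := congrArg (fun z : Fin (B + 1 + 1) → ℝ => (fun l : Fin (B + 1 + 1) => z ((Equiv.swap (Fin.castAdd 1 (Fin.last B)) (RebasePos.tI B)) l))) h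
    simpa only [swapYT_swapYT] using h'
  have himage : (fun w : Fin (B + 1 + 1) → ℝ => (fun l : Fin (B + 1 + 1) => w ((Equiv.swap (Fin.castAdd 1 (Fin.last B)) (RebasePos.tI B)) l))) '' D' = s.domain := by
    ext z
    constructor
    · rintro ⟨w, hw, rfl⟩
      exact (hΨdom w).1 hw
    · intro hz
      exact ⟨(fun l : Fin (B + 1 + 1) => z ((Equiv.swap (Fin.castAdd 1 (Fin.last B)) (RebasePos.tI B)) l)), (hΨdom _).2 (by rw [swapYT_swapYT]; exact hz), swapYT_swapYT z⟩
  have hmeas : MeasurableSet D' := IsSemialgebraic.measurableSet_holds hD'sa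
  have hf'int : IntegrableOn f' D' := by
    have h1 : IntegrableOn (fun w => |((LinearMap.toContinuousLinearMap (LinearMap.funLeft ℝ ℝ (Equiv.swap (Fin.castAdd 1 (Fin.last B)) (RebasePos.tI B))) : (Fin (B + 1 + 1) → ℝ) →L[ℝ] (Fin (B + 1 + 1) → ℝ))).det| • s.integrand (fun l : Fin (B + 1 + 1) => w ((Equiv.swap (Fin.castAdd 1 (Fin.last B)) (RebasePos.tI B)) l))) D' :=
      (integrableOn_image_iff_integrableOn_abs_det_fderiv_smul volume hmeas hderiv hinj
        s.integrand).1 (by rw [himage]; exact s.integrableOn)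
    refine h1.congr_fun (fun w hw => ?_) hmeas
    show |((LinearMap.toContinuousLinearMap (LinearMap.funLeft ℝ ℝ (Equiv.swap (Fin.castAdd 1 (Fin.last B)) (RebasePos.tI B))) : (Fin (B + 1 + 1) → ℝ) →L[ℝ] (Fin (B + 1 + 1) → ℝ))).det| • s.integrand (fun l : Fin (B + 1 + 1) => w ((Equiv.swap (Fin.castAdd 1 (Fin.last B)) (RebasePos.tI B)) l)) = f' w
    rw [abs_det_swapLin, one_smul, hff' w hw]
  let s' : KZ.IntegralRep (B + 1 + 1) := ⟨D', f', hD'sa, hf'sa, hf'int⟩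
  have hcov : KZ.of s' - KZ.of s ∈ KZ.relations :=
    KZ.changeOfVariablesRel_subset_relations ⟨B + 1 + 1, s', s, fun w => (fun l : Fin (B + 1 + 1) => w ((Equiv.swap (Fin.castAdd 1 (Fin.last B)) (RebasePos.tI B)) l)), fun _ => (LinearMap.toContinuousLinearMap (LinearMap.funLeft ℝ ℝ (Equiv.swap (Fin.castAdd 1 (Fin.last B)) (RebasePos.tI B))) : (Fin (B + 1 + 1) → ℝ) →L[ℝ] (Fin (B + 1 + 1) → ℝ)),
      hΨsa, hderiv, hinj, himage.symm, fun w hw => by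
        show f' w = s.integrand (fun l : Fin (B + 1 + 1) => w ((Equiv.swap (Fin.castAdd 1 (Fin.last B)) (RebasePos.tI B)) l)) * |((LinearMap.toContinuousLinearMap (LinearMap.funLeft ℝ ℝ (Equiv.swap (Fin.castAdd 1 (Fin.last B)) (RebasePos.tI B))) : (Fin (B + 1 + 1) → ℝ) →L[ℝ] (Fin (B + 1 + 1) → ℝ))).det|
        rw [abs_det_swapLin, mul_one, hff' w hw], rfl⟩
  refine ⟨((Finset.univ.image fun j => (if (M j).1 (Fin.last B) = 0 then ((Sum.inr 0, Sum.inr (M j)) : ((Fin 1 ⊕ ((Fin (B + 1) → ℚ) × ℚ)) × (Fin 1 ⊕ ((Fin (B + 1) → ℚ) × ℚ)))) else if 0 < (M j).1 (Fin.last B) then (Sum.inr (((Fin.snoc (fun i : Fin B => -(M j).1 (Fin.castSucc i) / (M j).1 (Fin.last B)) 0 : Fin (B + 1) → ℚ), -(M j).2 / (M j).1 (Fin.last B)) : (Fin (B + 1) → ℚ) × ℚ), Sum.inl 0) else (Sum.inl 0, Sum.inr (((Fin.snoc (fun i : Fin B => -(M j).1 (Fin.castSucc i) / (M j).1 (Fin.last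 B)) 0 : Fin (B + 1) → ℚ), -(M j).2 / (M j).1 (Fin.last B)) : (Fin (B + 1) → ℚ) × ℚ)))) ∪ (({(if 0 < u.1 (Fin.last B) then ((Sum.inl 0, Sum.inr (((Fin.snoc (fun i : Fin B => -u.1 (Fin.castSucc i) / u.1 (Fin.last B)) (1 / u.1 (Fin.last B)) : Fin (B + 1) → ℚ), -u.2 / u.1 (Fin.last B)) : (Fin (B + 1) → ℚ) × ℚ)) : ((Fin 1 ⊕ ((Fin (B + 1) → ℚ) × ℚ)) × (Fin 1 ⊕ ((Fin (B + 1) → ℚ) × ℚ)))) else (Sum.inr (((Fin.snoc (fun i : Fin B => -u.1 (Fin.castSucc i) / u.1 (Fin.last B)) (1 / u.1 (Fin.last B)) : Fin (B + 1) → ℚ), -u.2 / u.1 (Fin.last B)) : (Fin (B + 1) → ℚ) × ℚ), Sum.inl 0)), (if 0 < v.1 (Fin.last B) then ((Sum.inr (((Fin.snoc (fun i : Fin B => -v.1 (Fin.castSucc i) / v.1 (Fin.last B)) (1 / v.1 (Fin.last B)) : Fin (B + 1) → ℚ), -v.2 / v.1 (Fin.last B)) : (Fin (B + 1) → ℚ)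 × ℚ), Sum.inl 0) : ((Fin 1 ⊕ ((Fin (B + 1) → ℚ) × ℚ)) × (Fin 1 ⊕ ((Fin (B + 1) → ℚ) × ℚ)))) else (Sum.inl 0, Sum.inr (((Fin.snoc (fun i : Fin B => -v.1 (Fin.castSucc i) / v.1 (Fin.last B)) (1 / v.1 (Fin.last B)) : Fin (B + 1) → ℚ), -v.2 / v.1 (Fin.last B)) : (Fin (B + 1) → ℚ) × ℚ)))}) : Finset ((Fin 1 ⊕ ((Fin (B + 1) → ℚ) × ℚ)) × (Fin 1 ⊕ ((Fin (B + 1) → ℚ) × ℚ))))), s', swC_hlu M u v hsame, swC_players M u v, rfl, hΨdom, ?_,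
    fun w _ => rfl, ?_⟩
  · obtain ⟨R, hR0, hR⟩ := hbd.exists_pos_norm_le
    rw [isBounded_iff_forall_norm_le]
    refine ⟨R, fun w hw => (pi_norm_le_iff_of_nonneg hR0.le).2 fun l => ?_⟩
    have h := norm_le_pi_norm (fun l : Fin (B + 1 + 1) => w ((Equiv.swap (Fin.castAdd 1 (Fin.last B)) (RebasePos.tI B)) l)) ((Equiv.swap (Fin.castAdd 1 (Fin.last B)) (tI B)) l)
    simp only [Equiv.swap_apply_self] at h
    exact h.trans (hR _ ((hΨdom w).1 hw))
  · have := KZ.relations.neg_mem hcov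
    rwa [neg_sub] at this

end SwapMove

end RebasePos

/-- **Registered part of `stub_rebaseSimplePosOne` (line `janus-bands`, v6.2): the coordinate
swap `y ↔ t` of a one-fibre band.** A literal one-fibre band over a base of dimension `B + 1`
with letter `0`, transverse affine bounds `u < t < v` of the same sign in `y`, exponents
`n₁ = 0`, `n₂ = 1` (the base factor `g(x')/(y − ℓ₂(x'))`) is congruent modulo `KZ.relations`
(rule 2, a permutation of coordinates) to a bounded representation with order-constrained
domain (the new fibre is `y`, the new distinguished base coordinate is `t`; every fibre compared
from both sides, affine players free of the new base coordinate or the two transverse forms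
`(Y − u(x', 0))/u_y`, `(Y − v(x', 0))/v_y`) and the literal integrand `g(x') · 1/Y · 1/(T − ℓ₂(x'))`
(`RebasePos.swapBandYT`). -/
theorem rebaseSimplePos_swapYT (B m m' : ℕ) (s : KZ.IntegralRep (B + 1 + 1)) (M : Fin m' → (Fin (B + 1) → ℚ) × ℚ) (L : Fin m → (Fin B → ℚ) × ℚ) (e : Fin m → ℕ) (p : MvPolynomial (Fin B) ℚ) (ℓ₁ ℓ₂ : (Fin B → ℚ) × ℚ) (u v : (Fin (B + 1) → ℚ) × ℚ) (hbd : Bornology.IsBounded s.domain) (hdom : s.domain = SeparatePos.gDom B 1 m' M (fun _ => Sum.inr u) (fun _ => Sum.inr v)) (hint : EqOn s.integrand (RebasePos.glit B 1 p L e ℓ₁ ℓ₂ 0 1 (fun _ => some 0)) s.domain) (hu : u.1 (Fin.last B) ≠ 0) (hv : v.1 (Fin.last B) ≠ 0) (hsame : 0 < u.1 (Fin.last B) ↔ 0 < v.1 (Fin.last B)) : ∃ (C : Finset ((Fin 1 ⊕ ((Fin (B + 1) → ℚ) × ℚ)) × (Fin 1 ⊕ ((Fin (B + 1) → ℚ)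 × ℚ)))) (s' : KZ.IntegralRep (B + 1 + 1)), (∀ i, (∃ q ∈ C, q.2 = Sum.inl i) ∧ (∃ q ∈ C, q.1 = Sum.inl i)) ∧ (∀ q ∈ C, ∀ d, (q.1 = Sum.inr d ∨ q.2 = Sum.inr d) → d.1 (Fin.last B) = 0 ∨ d = (((Fin.snoc (fun i : Fin B => -u.1 (Fin.castSucc i) / u.1 (Fin.last B)) (1 / u.1 (Fin.last B)) : Fin (B + 1) → ℚ), -u.2 / u.1 (Fin.last B)) : (Fin (B + 1) → ℚ) × ℚ) ∨ d = (((Fin.snoc (fun i : Fin B => -v.1 (Fin.castSucc i) / v.1 (Fin.last B)) (1 / v.1 (Fin.last B)) : Fin (B + 1) → ℚ), -v.2 / v.1 (Fin.last B)) : (Fin (B + 1) → ℚ) × ℚ)) ∧ s'.domain = {w | ∀ q ∈ C, RebasePos.pv q.1 w < RebasePos.pv q.2 w} ∧ (∀ w, w ∈ s'.domain ↔ (fun l : Fin (B + 1 + 1) => w ((Equiv.swap (Fin.castAdd 1 (Fin.last B)) (RebasePos.tI B)) l)) ∈ s.domain) ∧ Bornology.IsBounded s'.domain ∧ EqOn s'.integrand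 (RebasePos.glit B 1 p L e ℓ₁ 0 0 1 (fun _ => some (((Fin.snoc ℓ₂.1 0 : Fin (B + 1) → ℚ), ℓ₂.2) : (Fin (B + 1) → ℚ) × ℚ))) s'.domain ∧ KZ.of s - KZ.of s' ∈ KZ.relations :=
  RebasePos.swapBandYT L e ℓ₁ ℓ₂ s M p u v hbd hdom hint hu hv hsame

end Summit.KontsevichZagierPeriods.ArrangementNormalForm.JanusBands
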